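import Summits.Ventures.HSemireg.WedgeHankelRecurrenceGaussChebyshevSComposition

/-!
# Venture HSemireg — **FIBRE NESTING UNDER COMPOSITION: `C_n − c ∣ C_{kn} − C_k(c)` and `T_n − c ∣ T_{kn} − T_k(c)` for all `k, n ∈ ℤ` and every constant `c`, in every commutative ring** (from
# `C_{kn} = C_k ∘ C_n`, `T_{kn} = T_k ∘ T_n` and `q − c ∣ p(q) − p(c)`); in particular the FIXED-POINT DIVISIBILITIES **`C_n − 2 ∣ C_{kn} − 2`**, **`T_n − 1 ∣ T_{kn} − 1`** (all `k`) and
# **`C_n + 2 ∣ C_{kn} + 2`**, **`T_n + 1 ∣ T_{kn} + 1`** (odd `k`): the level sets `{T_n = ±1}` (Gauss–Lobatto ∕ Radau–Chebyshev endpoints-and-extrema sets, cf. N478) are nested along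
# multiples of `n`

HONEST FRAMING. Part of the Lean index of the computation cell `pub-hsemireg` (seat p10 gen 48, Sunday typer «UNIFORM-IN-n»).  Polynomial algebra only; no variety, no cohomology theory, no sheaf,
no Ext group and no semiregularity map is constructed here; nothing here says that HC / HC_CM / HC_AV holds; no Literature fact (unproved `Prop`) is declared or used.  Custodian versions as in
`WedgeHankelSiegelIdeal` (1/3).
SOURCES (cited).  R. Lidl, G. L. Mullen, G. Turnwald, *Dickson Polynomials* (1993), Ch. 2–3 (composition `D_{mn} = D_m ∘ D_n`, fixed points of Dickson permutations); T. J. Rivlin, *Chebyshev Polynomials*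
(1990), §1.2 and Ch. 4 (`T_{mn} = T_m ∘ T_n`, iteration).
PROOF TYPED HERE.  Mathlib `Polynomial.Chebyshev.C_mul`, `T_mul` (composition), `C_eval_two`, `C_eval_neg_two`, `T_eval_one`, `T_eval_neg_one`, `Int.negOnePow_odd`, `Polynomial.X_sub_C_dvd_sub_C_eval`,
`sub_comp ∕ mul_comp ∕ X_comp ∕ C_comp`.
DEDUP DISCLOSURE (`rg -n 'sub_C_dvd_comp_sub_C|chebyshevC_sub_C_dvd|chebyshevT_sub_C_dvd|chebyshevC_sub_two_dvd|chebyshevC_add_two_dvd|chebyshevT_sub_one_dvd|chebyshevT_add_one_dvd' Summits Literature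
HarnessLib`, 2026-09-04): `Literature/Algebra/Polynomial/ZassenhausMinimalPolynomial.lean` has a PRIVATE `sub_C_dvd_comp_sub_C` over a field (same one-line lemma; private, so restated here under a
new name for commutative rings); N433 (`T_n ∣ …` divisibilities), N438 ∕ N487 (`U`, `S` nesting) — different statements; 0 hits for the 9 names below.

WHAT IS IN THE TREE.  N433, N438, N478, N487; Mathlib `C_mul`, `T_mul`.
THIS FILE (namespace `Summit.Ventures.HSemireg.Wedge.HankelOuter` continued; CHAINED on N487; 0 definitions):
* §1253 `chebyshev_sub_C_dvd_comp_sub_C`, **`chebyshevC_sub_C_dvd`**, **`chebyshevT_sub_C_dvd`**, **`chebyshevC_sub_two_dvd`**, **`chebyshevC_add_two_dvd`**, **`chebyshevT_sub_one_dvd`**,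
  **`chebyshevT_add_one_dvd`**, `chebyshevC_eval_eq_two_of_eval_eq_two`, `chebyshevT_eval_eq_one_of_eval_eq_one`.
CAVEATS.  Nothing Ext-side.  New names only.
-/

open Module Polynomial
open scoped Matrix Polynomial

namespace Summit.Ventures.HSemireg.Wedge.HankelOuter

/-! ## §1253. Fibre nesting under `C_{kn} = C_k ∘ C_n`, `T_{kn} = T_k ∘ T_n` -/

/-- `q − c ∣ p(q) − p(c)` for polynomials `p, q` and a constant `c` over a commutative ring (the composition form of `X − c ∣ p − p(c)`). [bookkeeping; this file, §1253] -/
theorem chebyshev_sub_C_dvd_comp_sub_C {R : Type*} [CommRing R] (p q : R[X]) (c : R) :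
    q - Polynomial.C c ∣ p.comp q - Polynomial.C (p.eval c) := by
  obtain ⟨s, hs⟩ := Polynomial.X_sub_C_dvd_sub_C_eval (p := p) (a := c)
  refine ⟨s.comp q, ?_⟩
  have h := congrArg (fun r => r.comp q) hs
  simp only [sub_comp, mul_comp, X_comp, C_comp] at h
  exact h

/-- **`C_n − c ∣ C_{kn} − C_k(c)`** for all `k, n ∈ ℤ`, every constant `c`, every commutative ring. [Lidl–Mullen–Turnwald Ch. 2; this file, §1253] -/
theorem chebyshevC_sub_C_dvd {R : Type*} [CommRing R] (k n : ℤ) (c : R) :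
    Polynomial.Chebyshev.C R n - Polynomial.C c ∣ Polynomial.Chebyshev.C R (k * n) - Polynomial.C ((Polynomial.Chebyshev.C R k).eval c) := by
  rw [Polynomial.Chebyshev.C_mul]
  exact chebyshev_sub_C_dvd_comp_sub_C _ _ c

/-- **`T_n − c ∣ T_{kn} − T_k(c)`** for all `k, n ∈ ℤ`, every constant `c`, every commutative ring. [Rivlin §1.2; this file, §1253] -/
theorem chebyshevT_sub_C_dvd {R : Type*} [CommRing R] (k n : ℤ) (c : R) :
    Polynomial.Chebyshev.T R n - Polynomial.C c ∣ Polynomial.Chebyshev.T R (k * n) - Polynomial.C ((Polynomial.Chebyshev.T R k).eval c) := by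
  rw [Polynomial.Chebyshev.T_mul]
  exact chebyshev_sub_C_dvd_comp_sub_C _ _ c

/-- **`C_n − 2 ∣ C_{kn} − 2`** for all `k, n ∈ ℤ` (the fixed points `C_n(x) = 2`, i.e. `x = t + t⁻¹` with `t^n = 1`, are fixed by every `C_{kn}`). [Lidl–Mullen–Turnwald Ch. 3; this file, §1253] -/
theorem chebyshevC_sub_two_dvd {R : Type*} [CommRing R] (k n : ℤ) :
    Polynomial.Chebyshev.C R n - 2 ∣ Polynomial.Chebyshev.C R (k * n) - 2 := by
  have h := chebyshevC_sub_C_dvd (R := R) k n 2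
  rwa [Polynomial.Chebyshev.C_eval_two, Polynomial.C_ofNat] at h

/-- **`C_n + 2 ∣ C_{kn} + 2`** for odd `k` and all `n ∈ ℤ` (`C_k(−2) = −2` for odd `k`). [this file, §1253] -/
theorem chebyshevC_add_two_dvd {R : Type*} [CommRing R] {k : ℤ} (hk : Odd k) (n : ℤ) :
    Polynomial.Chebyshev.C R n + 2 ∣ Polynomial.Chebyshev.C R (k * n) + 2 := by
  have hev : (Polynomial.Chebyshev.C R k).eval (-2) = -2 := by
    rw [Polynomial.Chebyshev.C_eval_neg_two, Int.negOnePow_odd _ hk]; simp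
  have h := chebyshevC_sub_C_dvd (R := R) k n (-2)
  rwa [hev, Polynomial.C_neg, Polynomial.C_ofNat, sub_neg_eq_add, sub_neg_eq_add] at h

/-- **`T_n − 1 ∣ T_{kn} − 1`** for all `k, n ∈ ℤ` (the set `{T_n = 1}` — `x = 1` and the double Radau–Chebyshev points, N478 — is nested along multiples of `n`). [Rivlin §1.2; this file, §1253] -/
theorem chebyshevT_sub_one_dvd {R : Type*} [CommRing R] (k n : ℤ) :
    Polynomial.Chebyshev.T R n - 1 ∣ Polynomial.Chebyshev.T R (k * n) - 1 := by
  have h := chebyshevT_sub_C_dvd (R := R) k n 1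
  rwa [Polynomial.Chebyshev.T_eval_one, Polynomial.C_1] at h

/-- **`T_n + 1 ∣ T_{kn} + 1`** for odd `k` and all `n ∈ ℤ` (`T_k(−1) = −1` for odd `k`). [Rivlin §1.2; this file, §1253] -/
theorem chebyshevT_add_one_dvd {R : Type*} [CommRing R] {k : ℤ} (hk : Odd k) (n : ℤ) :
    Polynomial.Chebyshev.T R n + 1 ∣ Polynomial.Chebyshev.T R (k * n) + 1 := by
  have hev : (Polynomial.Chebyshev.T R k).eval (-1) = -1 := by
    rw [Polynomial.Chebyshev.T_eval_neg_one, Int.negOnePow_odd _ hk]; simp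
  have h := chebyshevT_sub_C_dvd (R := R) k n (-1)
  rwa [hev, Polynomial.C_neg, Polynomial.C_1, sub_neg_eq_add, sub_neg_eq_add] at h

/-- If `C_n(x) = 2` then `C_{kn}(x) = 2` (all `k, n ∈ ℤ`). [this file, §1253] -/
theorem chebyshevC_eval_eq_two_of_eval_eq_two {R : Type*} [CommRing R] (k n : ℤ) {x : R} (hx : (Polynomial.Chebyshev.C R n).eval x = 2) :
    (Polynomial.Chebyshev.C R (k * n)).eval x = 2 := by
  obtain ⟨s, hs⟩ := chebyshevC_sub_two_dvd (R := R) k n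
  have h := congrArg (Polynomial.eval x) hs
  rw [eval_sub, eval_mul, eval_sub, hx, eval_ofNat, sub_self, zero_mul, sub_eq_zero] at h
  exact h

/-- If `T_n(x) = 1` then `T_{kn}(x) = 1` (all `k, n ∈ ℤ`). [this file, §1253] -/
theorem chebyshevT_eval_eq_one_of_eval_eq_one {R : Type*} [CommRing R] (k n : ℤ) {x : R} (hx : (Polynomial.Chebyshev.T R n).eval x = 1) :
    (Polynomial.Chebyshev.T R (k * n)).eval x = 1 := by
  obtain ⟨s, hs⟩ := chebyshevT_sub_one_dvd (R := R) k n
  have h := congrArg (Polynomial.eval x) hs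
  rw [eval_sub, eval_mul, eval_sub, hx, eval_one, sub_self, zero_mul, sub_eq_zero] at h
  exact h

end Summit.Ventures.HSemireg.Wedge.HankelOuter
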